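import Literature.AnabelianGeometry.EtaleTheta.Discharge.Sec3Cor38Thm34RowsTreeVocab
import Literature.AlgebraicGeometry.Frobenioids.EquivalencePreStepsFSMFF2008Assembly
import HarnessLib

/-!
# [EtTh] Cor 3.8 proof rows at the canonical [FrdI] vocabulary — the named-fact binder `h34 := FrdI.Thm34ii`
# INSTANTIATED by the tree's theorem `FrdI.Thm34ii_holds` (rows F-2809, F-2810, F-2812, F-2815, F-2816 modulo `hBmon_i`
# only)

S. Mochizuki, *The étale theta function and its Frobenioid-theoretic manifestations*, Publ. RIMS **45** (2009)
[MochizukiEtTh2009], Cor. 3.8, proof, PDF p.81 [cite: MochizukiEtTh2009, Cor 3.8 p.81]; S. Mochizuki, *The geometry of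
Frobenioids I*, Kyushu J. Math. **62** (2008), Thm. 3.4 (ii) p.62 [cite: MochizukiFrdI2008, Thm. 3.4 (ii) p.62].

PROOF-ONLY sequel (cell abc-iut, seat abc-iut-f-001) of `Sec3Cor38Thm34RowsTreeVocab.lean` (p430635; the Cor. 4.11
(ii) companions `Sec3Cor38BaseSquaresTreeVocab.lean` / `Sec3Cor38BaseSquaresFSMFF.lean` keep their own binders): that file proves the Cor. 3.8 proof rows over `Cor38Hyp` at the canonical vocabulary
taking [FrdI] Thm. 3.4 (ii) (2008 wording) as the 0-ary named-fact BINDER `h34 : FrdI.Thm34ii` — only because the olean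
of abc-iut-L1-t11's `EquivalencePreStepsFSMFF2008Assembly.lean` (p427329, `FrdI.Thm34ii_holds`) was not yet served by the
farm.  Here the binder is instantiated: every row holds at the canonical vocabulary modulo the L2 standing residual
`hBmon_i : IsMonoidOn C_i.ratFnFunctor` ("`𝔹` a monoid on `D`", [FrdI] Thm. 5.2 preamble) and print's own case
hypotheses ONLY.  One-line corollaries; no definition; names end in `_of_isMonoidOn` (deliberately NOT `_holds`: the
rows stay conditional on `hBmon_i`).  Nothing here bears on [IUTchIII] Cor. 3.12; typed ≠ proved elsewhere.
-/

namespace Literature.AnabelianGeometry.EtaleTheta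

open CategoryTheory Opposite Literature.AlgebraicGeometry.Frobenioids

universe u₀ v₀ u v w

namespace Cor38Hyp

section TreeVocab

variable {D₀ : Type u₀} [Category.{v₀} D₀] {D₀' : Type u₀} [Category.{v₀} D₀']
  {T : RealifiedDivisorMonoids (D₀ := D₀) treeMonoidVocab.{w}}
  {T' : RealifiedDivisorMonoids (D₀ := D₀') treeMonoidVocab.{w}}
  {D : Type u} [Category.{v} D] {D' : Type u} [Category.{v} D']
  {IsRational IsStrictlyRational : (Dᵒᵖ ⥤ CommMonCat.{w}) → Prop}
  {IsRational' IsStrictlyRational' : (D'ᵒᵖ ⥤ CommMonCat.{w}) → Prop}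
  {C₁ : TemperedFrobenioid T D (treeCatVocab D IsRational IsStrictlyRational)}
  {C₂ : TemperedFrobenioid T' D' (treeCatVocab D' IsRational' IsStrictlyRational')}
  (h : Cor38Hyp C₁ C₂) (hBmon₁ : IsMonoidOn C₁.ratFnFunctor) (hBmon₂ : IsMonoidOn C₂.ratFnFunctor)

include hBmon₁ hBmon₂

/-- **Row F-2809 / C38-L02a at the canonical vocabulary, modulo `hBmon_i` only** — `Ψ`, `Ψ⁻¹` preserve pre-steps
([FrdI] Thm. 3.4 (ii) = `FrdI.Thm34ii_holds`). [cite: MochizukiEtTh2009, Cor 3.8 p.81] -/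
theorem preservesPreSteps_treeCatVocab_of_isMonoidOn : h.PreservesPreSteps :=
  h.preservesPreSteps_treeCatVocab FrdI.Thm34ii_holds hBmon₁ hBmon₂

/-- **Row F-2810 / C38-L02b at the canonical vocabulary, modulo `hBmon_i` only** — primary steps ([FrdI] Thm. 4.2 (i)).
[cite: MochizukiEtTh2009, Cor 3.8 p.81] -/
theorem preservesPrimarySteps_treeCatVocab_of_isMonoidOn : h.PreservesPrimarySteps :=
  h.preservesPrimarySteps_treeCatVocab FrdI.Thm34ii_holds hBmon₁ hBmon₂

/-- **Row F-2815 at the canonical vocabulary, modulo `hBmon_i` only** — linear morphisms ([FrdI] Thm. 3.4 (iii)).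
[cite: MochizukiEtTh2009, Cor 3.8 p.81] -/
theorem preservesLinear_treeCatVocab_of_isMonoidOn : h.PreservesLinear :=
  h.preservesLinear_treeCatVocab FrdI.Thm34ii_holds hBmon₁ hBmon₂

/-- **Row F-2812 / C38-L04, CASE (i) (`D_i` Frobenius-slim), modulo `hBmon_i` only** — `O^▷(−)` ([FrdI] Thm. 3.4 (iv)).
[cite: MochizukiEtTh2009, Cor 3.8 p.81] -/
theorem preservesOTri_treeCatVocab_of_isFrobeniusSlim_of_isMonoidOn (hFs : IsFrobeniusSlim D)
    (hFs' : IsFrobeniusSlim D') : h.PreservesOTri :=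
  h.preservesOTri_treeCatVocab_of_isFrobeniusSlim FrdI.Thm34ii_holds hBmon₁ hBmon₂ hFs hFs'

/-- **Row F-2816 / C38-L06, CASE (i), modulo `hBmon_i` and C38-L05 (F-2807) only.** [cite: MochizukiEtTh2009, Cor 3.8 p.81] -/
theorem preservesBsFldPreSteps_treeCatVocab_of_isFrobeniusSlim_of_isMonoidOn (hFs : IsFrobeniusSlim D)
    (hFs' : IsFrobeniusSlim D')
    (h5₁ : C₁.BsFldPreStepLimitCriterion
      (PreFrobenioidData.perfection (C₁.isFrobenioid_treeCatVocab_of_isMonoidOn hBmon₁)))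
    (h5₂ : C₂.BsFldPreStepLimitCriterion
      (PreFrobenioidData.perfection (C₂.isFrobenioid_treeCatVocab_of_isMonoidOn hBmon₂))) :
    h.PreservesBsFldPreSteps :=
  h.preservesBsFldPreSteps_treeCatVocab_of_isFrobeniusSlim FrdI.Thm34ii_holds hBmon₁ hBmon₂ hFs hFs' h5₁ h5₂

/-- **Row F-2812 / C38-L04, CASE (ii), from the two base squares of [FrdI] Cor. 4.11 (ii), modulo `hBmon_i` only.**
[cite: MochizukiEtTh2009, Cor 3.8 p.81] -/
theorem preservesOTri_treeCatVocab_of_baseSquares_of_isMonoidOn (hsq : h.BaseSquare) (hsq' : h.BaseSquareInv) :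
    h.PreservesOTri :=
  h.preservesOTri_treeCatVocab_of_baseSquares FrdI.Thm34ii_holds hBmon₁ hBmon₂ hsq hsq'

/-- **Row F-2816 / C38-L06, CASE (ii), from the two base squares, modulo `hBmon_i` and C38-L05 (F-2807) only.**
[cite: MochizukiEtTh2009, Cor 3.8 p.81] -/
theorem preservesBsFldPreSteps_treeCatVocab_of_baseSquares_of_isMonoidOn (hsq : h.BaseSquare)
    (hsq' : h.BaseSquareInv)
    (h5₁ : C₁.BsFldPreStepLimitCriterion
      (PreFrobenioidData.perfection (C₁.isFrobenioid_treeCatVocab_of_isMonoidOn hBmon₁)))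
    (h5₂ : C₂.BsFldPreStepLimitCriterion
      (PreFrobenioidData.perfection (C₂.isFrobenioid_treeCatVocab_of_isMonoidOn hBmon₂))) :
    h.PreservesBsFldPreSteps :=
  h.preservesBsFldPreSteps_treeCatVocab_of_baseSquares FrdI.Thm34ii_holds hBmon₁ hBmon₂ hsq hsq' h5₁ h5₂

/-- **C38-L03′ (structure-compatible perfection square), modulo `hBmon_i` only.** [cite: MochizukiEtTh2009, Cor 3.8 p.81] -/
theorem compatibleWithPerfectionR_treeCatVocab_of_isMonoidOn :
    h.CompatibleWithPerfectionR (C₁.isFrobenioid_treeCatVocab_of_isMonoidOn hBmon₁)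
      (C₂.isFrobenioid_treeCatVocab_of_isMonoidOn hBmon₂) :=
  h.compatibleWithPerfectionR_treeCatVocab FrdI.Thm34ii_holds hBmon₁ hBmon₂

end TreeVocab

end Cor38Hyp

end Literature.AnabelianGeometry.EtaleTheta
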